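import Summits.Ventures.PercRepro.S1PlaneCounts

/-!
# PercRepro — S1 PAIR INJECTION AND PER-FLAT WEIGHTS: `μ ≤ #pairs`, `β`, `RS`, `RB`, `7560·β ≤ weight·#pairs`
(p4, gen 14; SUBCLAIM-S1 §4, (A3) and the per-flat weights of Proposition A)

`proofs/SUBCLAIM-S1-p2.md` §4 PROPOSITION A, step (A3) and the weights, typed per `proofs/S1-LEAN-SPEC-p2.md` L1.5–L1.6
and the first half of L2. For a rank-`4` flat `F` (`M.closure F = F`, `M.eRk F = 4`), `pairsOf M F` are the pairs
`(C, B')` of a circuit `C ⊆ F` and a set `B' ⊆ F ∖ C` with `|C| + |B'| = 5` and `cl(C ∪ B') = F`. With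
`β_d(f) = Σ_{j=5}^{min(f,d)} C(f, j)`, `μ(5) = 1`, `μ(6) = 5`, `μ(7) = 15`, `μ(f) = C(f,5) − (2/5)·C(f,4)` for
`f = 8, 9, 10` and `7560 = lcm` of the denominators, `RS d = 7560·max_{5≤f≤7} β_d(f)/μ(f)` and
`RB d = 7560·max_{8≤f≤10} β_d(f)/μ(f)` are natural numbers.

* **`ncard_rank4Five_le_ncard_pairsOf`** (A3) — `Q ↦ (C, Q ∖ C)`, `C` a circuit inside the dependent five-set `Q`,
  injects `rank4Five M F` into `pairsOf M F` (`cl(Q) = F` because `r(Q) = r(F)`; the pair determines `Q`);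
* `pairsOf_finite`, `pairsOf_subset` — the pairs are finitely many, each inside `F`;
* **`pairsOf_subset_S0_of_eight_le`** — for `|F| ≥ 8` every pair lies in `S₀ = ⋃₀ circuitsLE M 5`, by the landed
  `big_flat_subset_sUnion_circuitsLE` (planes have `≤ 6` points, `|F| > 7`);
* `beta`, `RS`, `RB` — the explicit `ℕ`-functions of the spec; `ncard_subsets_Icc_le` — the subsets `B ⊆ F` with
  `5 ≤ |B| ≤ c` number at most `β_c(|F|)`;
* **`weight_small`**, **`weight_big`** — `7560·β_c(|F|) ≤ RS c · #pairsOf(F)` (`5 ≤ |F| ≤ 7`) resp.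
  `≤ RB c · #pairsOf(F)` (`8 ≤ |F| ≤ 10`), from the `μ`-bounds of `S1PlaneCounts` and the injection.
Axioms: standard.
-/

open scoped Matroid

namespace PercRepro

namespace S1

open Set

variable {α : Type}

/-- Both members of a pair of `pairsOf M F` lie in `F`. -/
theorem pairsOf_subset {M : Matroid α} {F : Set α} {x : Set α × Set α} (hx : x ∈ pairsOf M F) :
    x.1 ⊆ F ∧ x.2 ⊆ F :=
  ⟨hx.2.1, hx.2.2.1.trans sdiff_subset⟩

/-- `pairsOf M F` is finite when `F` is. -/
theorem pairsOf_finite (M : Matroid α) {F : Set α} (hFfin : F.Finite) : (pairsOf M F).Finite := by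
  apply (hFfin.finite_subsets.prod hFfin.finite_subsets).subset
  intro x hx
  exact Set.mem_prod.2 ⟨(pairsOf_subset hx).1, (pairsOf_subset hx).2⟩

/-- **(A3) THE INJECTION**: a rank-`4` five-subset `Q` of the rank-`4` flat `F` is dependent, hence contains a
circuit `C`; `Q ↦ (C, Q ∖ C)` is an injection of `rank4Five M F` into `pairsOf M F`. -/
theorem ncard_rank4Five_le_ncard_pairsOf (M : Matroid α) [M.Finite] {F : Set α} (hF : F ⊆ M.E)
    (hcl : M.closure F = F) (hr : M.eRk F = 4) : (rank4Five M F).ncard ≤ (pairsOf M F).ncard := by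
  classical
  have hFfin : F.Finite := M.ground_finite.subset hF
  -- a circuit inside every rank-`4` five-set
  have hex : ∀ Q ∈ rank4Five M F, ∃ C, M.IsCircuit C ∧ C ⊆ Q := by
    intro Q hQ
    obtain ⟨hQF, hQ5, hrQ⟩ := hQ
    obtain ⟨C, B', hC, hCQ, -, -, -, -⟩ :=
      Matroid.exists_circuit_extension_exact (hQF.trans hF) hrQ (by rw [hQ5]; norm_num)
    exact ⟨C, hC, hCQ⟩
  choose! c hc using hex
  refine Set.ncard_le_ncard_of_injOn (fun Q => (c Q, Q \ c Q)) ?_ ?_ (pairsOf_finite M hFfin)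
  · intro Q hQ
    obtain ⟨hcQ, hcQsub⟩ := hc Q hQ
    obtain ⟨hQF, hQ5, hrQ⟩ := hQ
    have hQfin : Q.Finite := hFfin.subset hQF
    have hcard : (c Q).ncard + (Q \ c Q).ncard = 5 := by
      rw [Set.ncard_sdiff' hcQsub hQfin, hQ5]
      have := Set.ncard_le_ncard hcQsub hQfin
      omega
    have hunion : c Q ∪ (Q \ c Q) = Q := Set.union_sdiff_cancel hcQsub
    refine ⟨hcQ, hcQsub.trans hQF, ?_, hcard, ?_⟩
    · intro x hx
      exact ⟨hQF hx.1, hx.2⟩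
    · show M.closure (c Q ∪ (Q \ c Q)) = F
      rw [hunion, closure_eq_closure_of_subset_of_eRk_le M hQfin hQF (by rw [hr, hrQ]), hcl]
  · intro Q hQ Q' hQ' h
    simp only [Prod.mk.injEq] at h
    have h1 : c Q ∪ (Q \ c Q) = Q := Set.union_sdiff_cancel (hc Q hQ).2
    have h2 : c Q' ∪ (Q' \ c Q') = Q' := Set.union_sdiff_cancel (hc Q' hQ').2
    calc Q = c Q ∪ (Q \ c Q) := h1.symm
      _ = c Q' ∪ (Q' \ c Q') := by rw [h.2, h.1]
      _ = Q' := h2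

/-- **The pairs of a big flat live inside `S₀`**: if `|F| ≥ 8`, every pair `(C, B') ∈ pairsOf M F` has
`C ∪ B' ⊆ ⋃₀ circuitsLE M 5` (the flat `F = cl(C ∪ B')` has more than `7` points; planes have `≤ 6`). -/
theorem pairsOf_subset_S0_of_eight_le (M : Matroid α) [M.Finite]
    (hplane : ∀ P ⊆ M.E, M.eRk P ≤ 3 → P.ncard ≤ 6) {F : Set α} (hF : F ⊆ M.E)
    (hr : M.eRk F = 4) (h8 : 8 ≤ F.ncard) :
    ∀ x ∈ pairsOf M F, x.1 ∪ x.2 ⊆ ⋃₀ Matroid.circuitsLE M 5 := by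
  intro x hx
  have hUF : x.1 ∪ x.2 ⊆ F := union_subset (pairsOf_subset hx).1 (pairsOf_subset hx).2
  have hUE : x.1 ∪ x.2 ⊆ M.E := hUF.trans hF
  have hclU : M.closure (x.1 ∪ x.2) = F := hx.2.2.2.2
  have hrU : M.eRk (x.1 ∪ x.2) ≤ (4 : ℕ) := by
    rw [← M.eRk_closure_eq, hclU, hr]; norm_num
  have hflat' : ∀ X ⊆ M.E, M.eRk X ≤ ((4 - 1 : ℕ) : ℕ∞) → X.ncard ≤ 6 := by
    intro X hX hrX
    exact hplane X hX (by simpa using hrX)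
  have hbig : 6 + 1 < (M.closure (x.1 ∪ x.2)).ncard := by rw [hclU]; omega
  have hsub := Matroid.big_flat_subset_sUnion_circuitsLE (M := M) (q := 4) (f' := 6) (by norm_num) hflat'
    hrU hbig
  exact (M.subset_closure _ hUE).trans hsub

/-- `β_d(f) = Σ_{j=5}^{min(f,d)} C(f, j)`: an upper bound for the number of subsets `B` of an `f`-set with
`5 ≤ |B| ≤ d`. -/
def beta (f d : ℕ) : ℕ := ∑ j ∈ Finset.Icc 5 (min f d), f.choose j

/-- `RS(d) = 7560·r_s(d) = max(7560·β_d(5), 1512·β_d(6), 504·β_d(7))` (with `β_d(5) ≤ 1`). -/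
def RS (d : ℕ) : ℕ := max 7560 (max (1512 * beta 6 d) (504 * beta 7 d))

/-- `RB(d) = 7560·r_b(d) = max(270·β_d(8), 100·β_d(9), 45·β_d(10))`. -/
def RB (d : ℕ) : ℕ := max (270 * beta 8 d) (max (100 * beta 9 d) (45 * beta 10 d))

/-- `β_c(5) ≤ 1`. -/
theorem beta_five_le (c : ℕ) : beta 5 c ≤ 1 := by
  unfold beta
  rcases Nat.lt_or_ge c 5 with h | h
  · rw [Finset.Icc_eq_empty (by omega), Finset.sum_empty]; exact Nat.zero_le _
  · rw [min_eq_left h]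
    simp

/-- The subsets `B ⊆ F` with `5 ≤ |B| ≤ c` number at most `β_c(|F|)`. -/
theorem ncard_subsets_Icc_le {F : Set α} (hFfin : F.Finite) (c : ℕ) :
    {B : Set α | B ⊆ F ∧ 5 ≤ B.ncard ∧ B.ncard ≤ c}.ncard ≤ beta F.ncard c := by
  classical
  have hsub : {B : Set α | B ⊆ F ∧ 5 ≤ B.ncard ∧ B.ncard ≤ c} ⊆
      ((Finset.Icc 5 (min F.ncard c)).biUnion
        (fun j => (hFfin.toFinset.powersetCard j).image (fun s : Finset α => (s : Set α))) : Finset (Set α)) := by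
    intro B hB
    obtain ⟨hBF, h5, hc⟩ := hB
    rw [Finset.mem_coe, Finset.mem_biUnion]
    refine ⟨B.ncard, ?_, (mem_image_powersetCard_iff hFfin _ B).2 ⟨hBF, rfl⟩⟩
    rw [Finset.mem_Icc]
    exact ⟨h5, le_min (Set.ncard_le_ncard hBF hFfin) hc⟩
  calc {B : Set α | B ⊆ F ∧ 5 ≤ B.ncard ∧ B.ncard ≤ c}.ncard
      ≤ (((Finset.Icc 5 (min F.ncard c)).biUnion
        (fun j => (hFfin.toFinset.powersetCard j).image (fun s : Finset α => (s : Set α))) : Finset (Set α)) :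
          Set (Set α)).ncard := Set.ncard_le_ncard hsub (Finset.finite_toSet _)
    _ = ((Finset.Icc 5 (min F.ncard c)).biUnion
        (fun j => (hFfin.toFinset.powersetCard j).image (fun s : Finset α => (s : Set α)))).card :=
          Set.ncard_coe_finset _
    _ ≤ ∑ j ∈ Finset.Icc 5 (min F.ncard c),
        ((hFfin.toFinset.powersetCard j).image (fun s : Finset α => (s : Set α))).card :=
          Finset.card_biUnion_le
    _ = beta F.ncard c := by
          unfold beta
          apply Finset.sum_congr rfl
          intro j _
          exact card_image_powersetCard hFfin j

/-- **The small flats** (`5 ≤ |F| ≤ 7`): `7560·β_c(|F|) ≤ RS c · #pairsOf(F)`. -/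
theorem weight_small (M : Matroid α) [M.Finite]
    (hline : ∀ L ⊆ M.E, M.eRk L ≤ 2 → L.ncard ≤ 3) (hplane : ∀ P ⊆ M.E, M.eRk P ≤ 3 → P.ncard ≤ 6)
    {F : Set α} (hF : F ⊆ M.E) (hcl : M.closure F = F) (hr : M.eRk F = 4) (h5 : 5 ≤ F.ncard)
    (h7 : F.ncard ≤ 7) (c : ℕ) : 7560 * beta F.ncard c ≤ RS c * (pairsOf M F).ncard := by
  have hinj := ncard_rank4Five_le_ncard_pairsOf M hF hcl hr
  have hRS1 : 7560 ≤ RS c := le_max_left _ _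
  have hRS2 : 1512 * beta 6 c ≤ RS c := (le_max_left _ _).trans (le_max_right _ _)
  have hRS3 : 504 * beta 7 c ≤ RS c := (le_max_right _ _).trans (le_max_right _ _)
  have h57 : F.ncard = 5 ∨ F.ncard = 6 ∨ F.ncard = 7 := by omega
  rcases h57 with h | h | h
  · have hμ := one_le_ncard_rank4Five_of_five M hF hr h
    have hb := beta_five_le c
    rw [h]
    nlinarith
  · have hμ := five_le_ncard_rank4Five_of_six M hline hplane hF hcl hr h
    rw [h]
    nlinarith
  · have hμ := fifteen_le_ncard_rank4Five_of_seven M hline hplane hF hcl hr h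
    rw [h]
    nlinarith

/-- **The big flats** (`8 ≤ |F| ≤ 10`): `7560·β_c(|F|) ≤ RB c · #pairsOf(F)`. -/
theorem weight_big (M : Matroid α) [M.Finite]
    (hline : ∀ L ⊆ M.E, M.eRk L ≤ 2 → L.ncard ≤ 3) (hplane : ∀ P ⊆ M.E, M.eRk P ≤ 3 → P.ncard ≤ 6)
    {F : Set α} (hF : F ⊆ M.E) (hcl : M.closure F = F) (hr : M.eRk F = 4) (h8 : 8 ≤ F.ncard)
    (h10 : F.ncard ≤ 10) (c : ℕ) : 7560 * beta F.ncard c ≤ RB c * (pairsOf M F).ncard := by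
  have hinj := ncard_rank4Five_le_ncard_pairsOf M hF hcl hr
  have hμ := five_mul_choose_le_ncard_rank4Five M hline hplane hF hcl hr
  have hRB1 : 270 * beta 8 c ≤ RB c := le_max_left _ _
  have hRB2 : 100 * beta 9 c ≤ RB c := (le_max_left _ _).trans (le_max_right _ _)
  have hRB3 : 45 * beta 10 c ≤ RB c := (le_max_right _ _).trans (le_max_right _ _)
  have h810 : F.ncard = 8 ∨ F.ncard = 9 ∨ F.ncard = 10 := by omega
  rcases h810 with h | h | h
  · rw [h] at hμ ⊢
    have e1 : Nat.choose 8 5 = 56 := by decide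
    have e2 : Nat.choose 8 4 = 70 := by decide
    rw [e1, e2] at hμ
    nlinarith
  · rw [h] at hμ ⊢
    have e1 : Nat.choose 9 5 = 126 := by decide
    have e2 : Nat.choose 9 4 = 126 := by decide
    rw [e1, e2] at hμ
    nlinarith
  · rw [h] at hμ ⊢
    have e1 : Nat.choose 10 5 = 252 := by decide
    have e2 : Nat.choose 10 4 = 210 := by decide
    rw [e1, e2] at hμ
    nlinarith

end S1

end PercRepro
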